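import Mathlib
import Summits.MatrixMultiplication.MatrixMultiplication.Theorems.FourierTwoFamiliesModPCyclicReductionTransfer
import Summits.MatrixMultiplication.MatrixMultiplication.Theorems.FourierTwoFamiliesModPPrimeTwoFamiliesCapacityLift

/-!
# Carry-free form of stub `stub_honestOfSelfConverse`, crux `PrimeTwoFamilies` (stmt-MatrixMultiplication-14308)

Line `Sketch` (capacity-gadget form) of route `FourierTwoFamiliesModP`, crux
`Summit.MatrixMultiplication.MatrixMultiplication.Theses.FourierTwoFamiliesModP.PrimeTwoFamilies`
(CKSU 2005 Conj. 4.7 with prime cyclic hosts).  The registered stub `stub_honestOfSelfConverse` says: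
SELF-CONVERSE GADGETS (for every `ε > 0`, arbitrarily large `m`, `r ≥ m^{1-ε}` direct pairs `(P c, Q c)` in
`ℤ/m` of co-volume `≥ m^{1-ε}`, and a map `π` under which every ordered pair of distinct letters is strongly
separated directly or after `π`) give, for every `ε > 0` and arbitrarily large moduli, an HONEST family
(clauses (W) ∧ (X) of the simultaneous double product property verbatim) of `n ≥ m^{1/2-ε}` pairs of
co-volume `≥ m^{1-ε}` in a CYCLIC group `ℤ/m`.  It is landed as `CapacityLift.stub_honestOfSelfConverse`
(popular point + `π`-images, inside the same `ℤ/m`).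

This support file gives an independent, fully explicit second construction, ending at
`honest_of_selfConverse_le_half` (the stub for `0 < ε ≤ 1/2`, from which the registered signature follows by
`min ε (1/2)` and monotonicity of `m^{·}` in the exponent; that last step is not repeated here).  The
witness is a CERTIFICATE built from the gadget in three named steps:

1. the graph-word code of length 2 (`CapacityLift.selfConverseLift`): the `r` blocks
   `(P σ ×ˢ P (π σ), Q σ ×ˢ Q (π σ))` form an honest family in `ℤ/m × ℤ/m`;
2. the CARRY-FREE DIGIT MAP `(u, v) ↦ u.val + 2m · v.val : ℤ/m × ℤ/k → ℤ/N` (`4mk ≤ N`; here `k = m`,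
   `N = 4m²`) reflects two-fold sums (`twoDigit_reflect₂`; finite core `digits_unique` = uniqueness of
   two-digit expansions, and the no-overflow bound `twoDigit_add_lt`), so by the tree's transfer lemmas
   (`sdpp_direct_image_of_reflect₂`, `sdpp_cross_image_of_reflect₂`, `injective_of_reflect₂`) the images are
   an honest family of the same sizes in the cyclic group `ℤ/(4m²)` — no prime host and no Freiman
   machinery (`exists_prime_sdpp_of_addEquiv`) are needed, and the new modulus is explicit;
3. exponent bookkeeping at the new modulus `4m²` (`fourMulSq_rpow_le`: `(4m²)^z ≤ m^{2z+ε}` once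
   `4 ≤ m^ε`, i.e. `m ≥ ⌈4^{1/ε}⌉₊`).

Landed `--supports stmt-MatrixMultiplication-14308`.  Imports: Mathlib, the route's transfer support file
and the capacity lift; no new definitions.
-/

-- single-conjunct summit: the mandated namespace repeats `MatrixMultiplication` (summit = sub-problem).
set_option linter.dupNamespace false

namespace Summit.MatrixMultiplication.MatrixMultiplication.Theorems.PrimeTwoFamilies.CapacityLift.CarryFree

open Finset
open Summit.MatrixMultiplication.MatrixMultiplication.Theorems

/-! ## The finite core: carry-free two-digit expansions -/

/-- **Uniqueness of two-digit expansions** (the finite core of the carry-free transfer): if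
`x + M·y = x' + M·y'` with lower digits `x, x' < M`, then `x = x'` and `y = y'`. -/
theorem digits_unique {M x y x' y' : ℕ} (hx : x < M) (hx' : x' < M)
    (h : x + M * y = x' + M * y') : x = x' ∧ y = y' := by
  have hM : 0 < M := lt_of_le_of_lt (Nat.zero_le x) hx
  have h1 : (x + M * y) % M = (x' + M * y') % M := by rw [h]
  rw [Nat.add_mul_mod_self_left, Nat.add_mul_mod_self_left, Nat.mod_eq_of_lt hx,
    Nat.mod_eq_of_lt hx'] at h1
  subst h1
  exact ⟨rfl, Nat.eq_of_mul_eq_mul_left hM (Nat.add_left_cancel h)⟩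

/-- **No overflow**: for `a, b ∈ ℤ/m × ℤ/k` the sum of the two-digit codes
`a.1.val + 2m·a.2.val` and `b.1.val + 2m·b.2.val` is `< 4mk` (it is at most `(2m-2) + 2m(2k-2)`). -/
theorem twoDigit_add_lt {m k : ℕ} [NeZero m] [NeZero k] (a b : ZMod m × ZMod k) :
    a.1.val + 2 * m * a.2.val + (b.1.val + 2 * m * b.2.val) < 4 * m * k := by
  have h1 := a.1.val_lt
  have h2 := a.2.val_lt
  have h3 := b.1.val_lt
  have h4 := b.2.val_lt
  nlinarith

/-- **The carry-free digit map reflects two-fold sums** (a product of two cyclic groups sits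
two-sum-faithfully in any cyclic group of at least four times its order): for
`φ (u, v) = u.val + 2m·v.val (mod N)` on `ℤ/m × ℤ/k` with `4mk ≤ N`, `φ a + φ b = φ a' + φ b'` in `ℤ/N`
forces `a + b = a' + b'`.  (Both sides are naturals `< 4mk ≤ N`, hence equal; the lower digits
`a.1.val + b.1.val`, `a'.1.val + b'.1.val` are `< 2m`, so `digits_unique` splits the equality into the
two coordinates, which are then read back in `ℤ/m` and `ℤ/k`.)  With the tree's
`sdpp_direct_image_of_reflect₂` / `sdpp_cross_image_of_reflect₂` / `injective_of_reflect₂` this moves SDPP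
families from `ℤ/m × ℤ/k` into `ℤ/N` with all sizes kept (`N = 0`, i.e. `ℤ`, included). -/
theorem twoDigit_reflect₂ {m k N : ℕ} [NeZero m] [NeZero k] (hN : 4 * m * k ≤ N)
    (a b a' b' : ZMod m × ZMod k)
    (h : ((a.1.val + 2 * m * a.2.val : ℕ) : ZMod N) + ((b.1.val + 2 * m * b.2.val : ℕ) : ZMod N) =
      ((a'.1.val + 2 * m * a'.2.val : ℕ) : ZMod N) + ((b'.1.val + 2 * m * b'.2.val : ℕ) : ZMod N)) :
    a + b = a' + b' := by
  have h' : ((a.1.val + 2 * m * a.2.val + (b.1.val + 2 * m * b.2.val) : ℕ) : ZMod N) =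
      ((a'.1.val + 2 * m * a'.2.val + (b'.1.val + 2 * m * b'.2.val) : ℕ) : ZMod N) := by
    push_cast at h ⊢
    exact h
  rw [ZMod.natCast_eq_natCast_iff', Nat.mod_eq_of_lt ((twoDigit_add_lt a b).trans_le hN),
    Nat.mod_eq_of_lt ((twoDigit_add_lt a' b').trans_le hN)] at h'
  have h2 : (a.1.val + b.1.val) + 2 * m * (a.2.val + b.2.val) =
      (a'.1.val + b'.1.val) + 2 * m * (a'.2.val + b'.2.val) := by
    have e1 : a.1.val + 2 * m * a.2.val + (b.1.val + 2 * m * b.2.val) =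
        (a.1.val + b.1.val) + 2 * m * (a.2.val + b.2.val) := by ring
    have e2 : a'.1.val + 2 * m * a'.2.val + (b'.1.val + 2 * m * b'.2.val) =
        (a'.1.val + b'.1.val) + 2 * m * (a'.2.val + b'.2.val) := by ring
    rw [← e1, ← e2]
    exact h'
  have hlt : a.1.val + b.1.val < 2 * m := by
    have := a.1.val_lt
    have := b.1.val_lt
    omega
  have hlt' : a'.1.val + b'.1.val < 2 * m := by
    have := a'.1.val_lt
    have := b'.1.val_lt
    omega
  obtain ⟨e1, e2⟩ := digits_unique hlt hlt' h2
  have f1 : a.1 + b.1 = a'.1 + b'.1 := by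
    have := congrArg (Nat.cast : ℕ → ZMod m) e1
    simpa using this
  have f2 : a.2 + b.2 = a'.2 + b'.2 := by
    have := congrArg (Nat.cast : ℕ → ZMod k) e2
    simpa using this
  exact Prod.ext f1 f2

/-! ## Exponent bookkeeping at the modulus `4m²` -/

/-- **Threshold for the constant `4`**: for `m ≥ ⌈4^{1/ε}⌉₊` one has `4 ≤ m^ε`. -/
theorem four_le_rpow {ε : ℝ} (hε : 0 < ε) {m : ℕ} (hm : ⌈(4 : ℝ) ^ (1 / ε)⌉₊ ≤ m) :
    (4 : ℝ) ≤ (m : ℝ) ^ ε := by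
  have h2 : (4 : ℝ) ^ (1 / ε) ≤ (m : ℝ) := (Nat.le_ceil _).trans (by exact_mod_cast hm)
  have h3 : ((4 : ℝ) ^ (1 / ε)) ^ ε ≤ (m : ℝ) ^ ε :=
    Real.rpow_le_rpow (by positivity) h2 hε.le
  have h4 : ((4 : ℝ) ^ (1 / ε)) ^ ε = 4 := by
    rw [← Real.rpow_mul (by norm_num : (0 : ℝ) ≤ 4)]
    have : 1 / ε * ε = 1 := by field_simp
    rw [this, Real.rpow_one]
  rw [h4] at h3
  exact h3

/-- **Powers of the new modulus**: if `1 ≤ m`, `4 ≤ m^ε` and `z ≤ 1`, then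
`(4m²)^z ≤ m^{2z+ε}` (as `(4m²)^z = 4^z (m²)^z ≤ 4 · m^{2z} ≤ m^ε · m^{2z}`). -/
theorem fourMulSq_rpow_le {m : ℕ} {ε z : ℝ} (hm : 1 ≤ m) (h4 : (4 : ℝ) ≤ (m : ℝ) ^ ε) (hz : z ≤ 1) :
    (((4 * m ^ 2 : ℕ)) : ℝ) ^ z ≤ (m : ℝ) ^ (2 * z + ε) := by
  have hm1 : (1 : ℝ) ≤ m := by exact_mod_cast hm
  have hm0 : (0 : ℝ) < m := by linarith
  push_cast
  rw [Real.mul_rpow (by norm_num) (by positivity)]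
  have hsq : ((m : ℝ) ^ 2) ^ z = (m : ℝ) ^ (2 * z) := by
    rw [show ((m : ℝ) ^ 2) = (m : ℝ) ^ (2 : ℝ) from (Real.rpow_two _).symm, ← Real.rpow_mul hm0.le]
  have hfour : (4 : ℝ) ^ z ≤ 4 := by
    calc (4 : ℝ) ^ z ≤ (4 : ℝ) ^ (1 : ℝ) :=
          Real.rpow_le_rpow_of_exponent_le (by norm_num) hz
      _ = 4 := Real.rpow_one _
  have hpos : (0 : ℝ) ≤ (m : ℝ) ^ (2 * z) := (Real.rpow_pos_of_pos hm0 _).le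
  rw [hsq, Real.rpow_add hm0, mul_comm ((m : ℝ) ^ (2 * z))]
  exact mul_le_mul_of_nonneg_right (hfour.trans h4) hpos

/-! ## The construction -/

/-- **Self-converse gadgets contain honest designs, carry-free form (`0 < ε ≤ 1/2`).**  If for every
`ε > 0` there are arbitrarily large `m`, a gadget of `r ≥ m^{1-ε}` direct pairs `(P c, Q c)` in `ℤ/m` of
co-volume `|P c||Q c| ≥ m^{1-ε}`, and a map `π` under which every ordered pair of distinct letters is
strongly separated directly or after `π`, then for every `0 < ε ≤ 1/2` and every `m₀` some modulus `≥ m₀`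
(namely `4m²` for a gadget level `m ≥ max (max m₀ 1) ⌈4^{1/ε}⌉₊` of the hypothesis at `ε/2`) carries an
honest SDPP family ((W) ∧ (X) verbatim) of `n ≥ (4m²)^{1/2-ε}` pairs of co-volume `≥ (4m²)^{1-ε}`.
Construction: the `r` blocks `(P σ ×ˢ P (π σ), Q σ ×ˢ Q (π σ))` of `CapacityLift.selfConverseLift` are an
honest family in `ℤ/m × ℤ/m`; their images under the carry-free digit map are an honest family of the same
sizes in `ℤ/(4m²)` (`twoDigit_reflect₂` with the tree's `sdpp_*_image_of_reflect₂`, `injective_of_reflect₂`);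
and `(4m²)^{1/2-ε} ≤ m^{1-ε} ≤ m^{1-ε/2} ≤ r`, `(4m²)^{1-ε} ≤ m^{2-ε} = m^{1-ε/2} m^{1-ε/2} ≤ co-volume`
(`fourMulSq_rpow_le`).  The registered stub `stub_honestOfSelfConverse` (all `ε > 0`) follows by applying
this at `min ε (1/2)` and `max m₀ 1` and weakening the exponents (`m ≥ 1`); it is already landed as
`CapacityLift.stub_honestOfSelfConverse`, so that step is not restated here. -/
theorem honest_of_selfConverse_le_half
    (h : ∀ ε : ℝ, 0 < ε → ∀ m₀ : ℕ, ∃ m ≥ m₀, ∃ r : ℕ, ∃ P Q : Fin r → Finset (ZMod m),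
      ∃ π : Fin r → Fin r,
        (∀ c : Fin r, ∀ x ∈ P c, ∀ x' ∈ P c, ∀ y ∈ Q c, ∀ y' ∈ Q c,
            (x - x') + (y - y') = 0 → x = x' ∧ y = y') ∧
        (∀ σ τ : Fin r, σ ≠ τ →
            (∀ x ∈ P σ, ∀ y ∈ Q τ, ∀ c : Fin r, ∀ x' ∈ P c, ∀ y' ∈ Q c, y - x ≠ y' - x') ∨
            (∀ x ∈ P (π σ), ∀ y ∈ Q (π τ), ∀ c : Fin r, ∀ x' ∈ P c, ∀ y' ∈ Q c, y - x ≠ y' - x')) ∧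
        (m : ℝ) ^ (1 - ε) ≤ (r : ℝ) ∧
        ∀ c : Fin r, (m : ℝ) ^ (1 - ε) ≤ (((P c).card * (Q c).card : ℕ) : ℝ))
    {ε : ℝ} (hε : 0 < ε) (hε2 : ε ≤ 1 / 2) (m₀ : ℕ) :
    ∃ m ≥ m₀, ∃ n : ℕ, ∃ A B : Fin n → Finset (ZMod m),
      (∀ i : Fin n, ∀ a ∈ A i, ∀ a' ∈ A i, ∀ b ∈ B i, ∀ b' ∈ B i,
          (a - a') + (b - b') = 0 → a = a' ∧ b = b') ∧
      (∀ i j k : Fin n, ∀ a ∈ A i, ∀ a' ∈ A j, ∀ b ∈ B j, ∀ b' ∈ B k,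
          (a - a') + (b - b') = 0 → i = k) ∧
      (m : ℝ) ^ (1 / 2 - ε) ≤ (n : ℝ) ∧
      ∀ i : Fin n, (m : ℝ) ^ (1 - ε) ≤ (((A i).card * (B i).card : ℕ) : ℝ) := by
  obtain ⟨m, hm, r, P, Q, π, hD, hπ, hr, hcov⟩ :=
    h (ε / 2) (by linarith) (max (max m₀ 1) ⌈(4 : ℝ) ^ (1 / ε)⌉₊)
  have hm₀ : m₀ ≤ m := le_trans (le_trans (le_max_left _ _) (le_max_left _ _)) hm
  have hm1 : 1 ≤ m := le_trans (le_trans (le_max_right _ _) (le_max_left _ _)) hm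
  have hmc : ⌈(4 : ℝ) ^ (1 / ε)⌉₊ ≤ m := le_trans (le_max_right _ _) hm
  haveI : NeZero m := ⟨by omega⟩
  have hm1' : (1 : ℝ) ≤ m := by exact_mod_cast hm1
  have hm0' : (0 : ℝ) < m := by linarith
  have h4 : (4 : ℝ) ≤ (m : ℝ) ^ ε := four_le_rpow hε hmc
  -- step 1: the length-2 graph-word code in `ℤ/m × ℤ/m`
  obtain ⟨hW2, hX2⟩ := selfConverseLift P Q hD π hπ
  -- step 2: the carry-free digit map into `ℤ/(4m²)`
  set φ : ZMod m × ZMod m → ZMod (4 * m ^ 2) :=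
    fun u => ((u.1.val + 2 * m * u.2.val : ℕ) : ZMod (4 * m ^ 2))
  have hN : 4 * m * m ≤ 4 * m ^ 2 := le_of_eq (by ring)
  have hφr : ∀ a b a' b', φ a + φ b = φ a' + φ b' → a + b = a' + b' :=
    fun a b a' b' hab => twoDigit_reflect₂ hN a b a' b' hab
  have hinj : Function.Injective φ := injective_of_reflect₂ φ hφr
  refine ⟨4 * m ^ 2, ?_, r, fun σ => (P σ ×ˢ P (π σ)).image φ, fun σ => (Q σ ×ˢ Q (π σ)).image φ,
    sdpp_direct_image_of_reflect₂ φ hφr hW2, sdpp_cross_image_of_reflect₂ φ hφr hX2, ?_, ?_⟩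
  · -- `m₀ ≤ m ≤ 4 m²`
    exact hm₀.trans (by nlinarith)
  · -- `(4m²)^{1/2-ε} ≤ m^{1-ε} ≤ m^{1-ε/2} ≤ r`
    calc (((4 * m ^ 2 : ℕ)) : ℝ) ^ (1 / 2 - ε) ≤ (m : ℝ) ^ (2 * (1 / 2 - ε) + ε) :=
          fourMulSq_rpow_le hm1 h4 (by linarith)
      _ ≤ (m : ℝ) ^ (1 - ε / 2) := Real.rpow_le_rpow_of_exponent_le hm1' (by linarith)
      _ ≤ r := hr
  · -- `(4m²)^{1-ε} ≤ m^{2-ε} = m^{1-ε/2} · m^{1-ε/2} ≤ |P σ||Q σ| · |P (π σ)||Q (π σ)|`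
    intro σ
    rw [card_image_of_injective _ hinj, card_image_of_injective _ hinj, card_product, card_product]
    have hPQ := hcov σ
    have hPQ' := hcov (π σ)
    have h0 : (0 : ℝ) ≤ (m : ℝ) ^ (1 - ε / 2) := (Real.rpow_pos_of_pos hm0' _).le
    calc (((4 * m ^ 2 : ℕ)) : ℝ) ^ (1 - ε) ≤ (m : ℝ) ^ (2 * (1 - ε) + ε) :=
          fourMulSq_rpow_le hm1 h4 (by linarith)
      _ = (m : ℝ) ^ (1 - ε / 2) * (m : ℝ) ^ (1 - ε / 2) := by
          rw [← Real.rpow_add hm0']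
          congr 1
          ring
      _ ≤ (((P σ).card * (Q σ).card : ℕ) : ℝ) * (((P (π σ)).card * (Q (π σ)).card : ℕ) : ℝ) :=
          mul_le_mul hPQ hPQ' h0 (by positivity)
      _ = (((P σ).card * (P (π σ)).card * ((Q σ).card * (Q (π σ)).card) : ℕ) : ℝ) := by
          push_cast
          ring

end Summit.MatrixMultiplication.MatrixMultiplication.Theorems.PrimeTwoFamilies.CapacityLift.CarryFree
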